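import Mathlib
import Summits.Ventures.PercRepro2.Defs
import Summits.Ventures.PercRepro2.Harris
import Summits.Ventures.PercRepro2.Independence
import Summits.Ventures.PercRepro2.CoinDefs
import Summits.Ventures.PercRepro2.CoinReverse
import Summits.Ventures.PercRepro2.CoinStarDefs
import Summits.Ventures.PercRepro2.CoinLsmCoreDefs
import Summits.Ventures.PercRepro2.CoinLsmCoreU
import Summits.Ventures.PercRepro2.CoinCoreGate
import Summits.Ventures.PercRepro2.CoinTreeCore
import Summits.Ventures.PercRepro2.CoinTreeAncestor
import Summits.Ventures.PercRepro2.CoinOrTailAlg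
import Summits.Ventures.PercRepro2.CoinOrTailDefs
import Summits.Ventures.PercRepro2.CoinOrTailLsmDefs
import Summits.Ventures.PercRepro2.CoinOrTailLsmSums
import Summits.Ventures.PercRepro2.CoinOrTailBlockAlg
import Summits.Ventures.PercRepro2.CoinOrTailBlockSums
import Summits.Ventures.PercRepro2.CoinOrTailMixLsm
import Summits.Ventures.PercRepro2.CoinBlockTheoremII
import Summits.Ventures.PercRepro2.CoinLsmCoreSure
import Summits.Ventures.PercRepro2.CoinOrTailKDefs
import Summits.Ventures.PercRepro2.CoinOrTailKSums
import Summits.Ventures.PercRepro2.CoinOrTailKAlg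
import Summits.Ventures.PercRepro2.CoinOrTailCovCore

/-!
# Row 2′DARC at an OR-tail with ANY NUMBER OF ENTRIES — every route into the tail passes
through a marker (blind cell PercRepro2, night-2 g10; proofs/NIGHT2-DARC.md §41)

`darc_of_orTailLsmK`: an OR-tail with the entry set `ent` on a log-supermodular core `U`
(`OrTailK`) and two markers `m₁, m₂ ∈ U` that COVER the entries — a cluster of positive
probability containing an entry contains a marker (`hcov`) — give
`Φ_D({s ↛ t in D + (a → w)}) ≥ 0` at every head.  Corollaries: `darc_of_orTailLsmKDom` (each
entry dominated by `m₁` or by `m₂`) and `darc_of_orTailTreeK` (an out-tree core, each entry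
with `m₁` or `m₂` among its ancestors — any number of branches below the two markers feeding
the tail).  The two-entry theorems of §39–§40 are the case `ent = {r, q}`.

Proof: the block theorem (`orTailBlock_identity`, `orTailBlock_nonneg`) on the k-entry block
sums, with `H1`, `H2` from the unconditional log-supermodularity of `rValK` / `gValK`
(`CoinOrTailKAlg`, via the generic Ahlswede–Daykin step `cellBlock_mul_le`), `M₀₀ = Λ₀₀` from
the cover hypothesis, and the transport through `ClosedInCoreU.phiC_gate_eq` and
`OrTailK.sum_R_eq` / `sum_G_eq`.
-/

namespace Summit.Ventures.PercRepro2.Coin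

open Classical

section KBlocks

variable {V : Type*} {E : Type*} [DecidableEq V] {R : Type*} [Field R] [LinearOrder R]
  [IsStrictOrderedRing R]

/-- `0 ≤ tailWtK`. -/
lemma tailWtK_nonneg {pr : E → R} (hp1 : ∀ e, pr e ≤ 1) (ent : Finset V) (c : V → E)
    (W : Finset V) : 0 ≤ tailWtK pr ent c W := by
  unfold tailWtK
  refine Finset.prod_nonneg fun r _ => ?_
  have := hp1 (c r)
  split_ifs <;> linarith

/-- `tailWtK ≤ 1`. -/
lemma tailWtK_le_one {pr : E → R} (hp0 : ∀ e, 0 ≤ pr e) (hp1 : ∀ e, pr e ≤ 1) (ent : Finset V)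
    (c : V → E) (W : Finset V) : tailWtK pr ent c W ≤ 1 := by
  unfold tailWtK
  refine Finset.prod_le_one (fun r _ => ?_) (fun r _ => ?_)
  · have := hp1 (c r); split_ifs <;> linarith
  · have := hp0 (c r); split_ifs <;> linarith

omit [LinearOrder R] [IsStrictOrderedRing R] in
/-- The tail weight of a cluster without entries is `1`. -/
lemma tailWtK_eq_one_of_no_entry (pr : E → R) {ent : Finset V} (c : V → E) {W : Finset V}
    (hW : ∀ r ∈ ent, r ∉ W) : tailWtK pr ent c W = 1 := by
  unfold tailWtK
  refine Finset.prod_eq_one fun r hr => ?_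
  simp [hW r hr]

/-- `0 ≤ rValK`. -/
lemma rValK_nonneg {A : Finset V → R} {pr : E → R} (hp0 : ∀ e, 0 ≤ pr e) (hp1 : ∀ e, pr e ≤ 1)
    (hA0 : ∀ W, 0 ≤ A W) (ent : Finset V) (c : V → E) (a : V) (W : Finset V) :
    0 ≤ rValK A pr ent c a W := by
  unfold rValK
  have h0 := tailWtK_nonneg hp1 ent c W
  have h1 := tailWtK_le_one hp0 hp1 ent c W
  exact add_nonneg (mul_nonneg h0 (hA0 _)) (mul_nonneg (by linarith) (hA0 _))

/-- `0 ≤ gValK`. -/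
lemma gValK_nonneg {A : Finset V → R} {pr : E → R} (hp0 : ∀ e, 0 ≤ pr e) (hp1 : ∀ e, pr e ≤ 1)
    (hA0 : ∀ W, 0 ≤ A W) (ent : Finset V) (c : V → E) (a w : V) (W : Finset V) :
    0 ≤ gValK A pr ent c a w W := by
  unfold gValK
  have h0 := tailWtK_nonneg hp1 ent c W
  have h1 := tailWtK_le_one hp0 hp1 ent c W
  exact add_nonneg (mul_nonneg h0 (hA0 _)) (mul_nonneg (by linarith) (hA0 _))

/-- `gValK ≤ rValK`. -/
lemma gValK_le_rValK {A : Finset V → R} {pr : E → R} (hp0 : ∀ e, 0 ≤ pr e) (hp1 : ∀ e, pr e ≤ 1)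
    (hmono : ∀ s t : Finset V, s ⊆ t → A t ≤ A s) (ent : Finset V) (c : V → E) (a w : V)
    (W : Finset V) : gValK A pr ent c a w W ≤ rValK A pr ent c a W := by
  unfold gValK rValK
  have h1 := tailWtK_le_one hp0 hp1 ent c W
  have hsub : W ∪ {a} ⊆ W ∪ {a, w} :=
    Finset.union_subset_union_right (Finset.singleton_subset_iff.2 (Finset.mem_insert_self a {w}))
  have := hmono _ _ hsub
  nlinarith

omit [LinearOrder R] [IsStrictOrderedRing R] in
/-- On a cluster without entries the gate value is the `R`-value (the head value). -/
lemma gValK_eq_rValK_of_no_entry (A : Finset V → R) (pr : E → R) {ent : Finset V} (c : V → E)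
    (a w : V) {W : Finset V} (hW : ∀ r ∈ ent, r ∉ W) :
    gValK A pr ent c a w W = rValK A pr ent c a W := by
  unfold gValK rValK
  rw [tailWtK_eq_one_of_no_entry pr c hW]
  ring

end KBlocks

section KFunctional

variable {V : Type*} {E : Type*} [Fintype V] [DecidableEq V] {R : Type*} [Field R] [LinearOrder R]
  [IsStrictOrderedRing R]

/-- **THE k-ENTRY OR-TAIL FUNCTIONAL IS NONNEGATIVE FOR COVERING MARKERS** (block theorem). -/
theorem orTailK_functional_nonneg (U : Finset V) (ν A : Finset V → R) (pr : E → R)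
    (ent : Finset V) (c : V → E) (m₁ m₂ a w : V)
    (hp0 : ∀ e, 0 ≤ pr e) (hp1 : ∀ e, pr e ≤ 1)
    (hν0 : ∀ W, 0 ≤ ν W) (hν : ∀ s ⊆ U, ∀ t ⊆ U, ν s * ν t ≤ ν (s ∩ t) * ν (s ∪ t))
    (hcov : ∀ W ⊆ U, m₁ ∉ W → m₂ ∉ W → (∃ r ∈ ent, r ∈ W) → ν W = 0)
    (hA0 : ∀ W, 0 ≤ A W) (hA : ∀ s t : Finset V, A s * A t ≤ A (s ∩ t) * A (s ∪ t))
    (hmono : ∀ s t : Finset V, s ⊆ t → A t ≤ A s) :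
    0 ≤ (∑ W ∈ U.powerset, ν W * rValK A pr ent c a W) ^ 2 *
          (∑ W ∈ U.powerset, ν W * gValK A pr ent c a w W *
            ((if m₁ ∈ W then (1 : R) else 0) * (if m₂ ∈ W then (1 : R) else 0)))
        - (∑ W ∈ U.powerset, ν W * rValK A pr ent c a W) *
          (∑ W ∈ U.powerset, ν W * rValK A pr ent c a W * (if m₁ ∈ W then (1 : R) else 0)) *
          (∑ W ∈ U.powerset, ν W * gValK A pr ent c a w W * (if m₂ ∈ W then (1 : R) else 0))
        - (∑ W ∈ U.powerset, ν W * rValK A pr ent c a W) *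
          (∑ W ∈ U.powerset, ν W * rValK A pr ent c a W * (if m₂ ∈ W then (1 : R) else 0)) *
          (∑ W ∈ U.powerset, ν W * gValK A pr ent c a w W * (if m₁ ∈ W then (1 : R) else 0))
        + (∑ W ∈ U.powerset, ν W * rValK A pr ent c a W * (if m₁ ∈ W then (1 : R) else 0)) *
          (∑ W ∈ U.powerset, ν W * rValK A pr ent c a W * (if m₂ ∈ W then (1 : R) else 0)) *
          (∑ W ∈ U.powerset, ν W * gValK A pr ent c a w W) := by
  have hr0 : ∀ W, 0 ≤ rValK A pr ent c a W := fun W => rValK_nonneg hp0 hp1 hA0 ent c a W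
  have hg0 : ∀ W, 0 ≤ gValK A pr ent c a w W := fun W => gValK_nonneg hp0 hp1 hA0 ent c a w W
  have hνr0 : ∀ W, 0 ≤ ν W * rValK A pr ent c a W := fun W => mul_nonneg (hν0 W) (hr0 W)
  have hνg0 : ∀ W, 0 ≤ ν W * gValK A pr ent c a w W := fun W => mul_nonneg (hν0 W) (hg0 W)
  -- the pointwise lattice steps
  have hνr : ∀ s' ⊆ U, ∀ t' ⊆ U, ν s' * rValK A pr ent c a s' * (ν t' * rValK A pr ent c a t') ≤
      ν (s' ∩ t') * rValK A pr ent c a (s' ∩ t') * (ν (s' ∪ t') * rValK A pr ent c a (s' ∪ t')) := by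
    intro s' hs' t' ht'
    calc ν s' * rValK A pr ent c a s' * (ν t' * rValK A pr ent c a t')
        = (ν s' * ν t') * (rValK A pr ent c a s' * rValK A pr ent c a t') := by ring
      _ ≤ (ν (s' ∩ t') * ν (s' ∪ t')) *
            (rValK A pr ent c a (s' ∩ t') * rValK A pr ent c a (s' ∪ t')) :=
          mul_le_mul (hν s' hs' t' ht') (rValK_mul_le_all A pr ent c a hp0 hp1 hA0 hA hmono s' t')
            (mul_nonneg (hr0 _) (hr0 _)) (mul_nonneg (hν0 _) (hν0 _))
      _ = ν (s' ∩ t') * rValK A pr ent c a (s' ∩ t') *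
            (ν (s' ∪ t') * rValK A pr ent c a (s' ∪ t')) := by ring
  have hνg : ∀ s' ⊆ U, ∀ t' ⊆ U,
      ν s' * gValK A pr ent c a w s' * (ν t' * gValK A pr ent c a w t') ≤
      ν (s' ∩ t') * rValK A pr ent c a (s' ∩ t') *
        (ν (s' ∪ t') * gValK A pr ent c a w (s' ∪ t')) := by
    intro s' hs' t' ht'
    calc ν s' * gValK A pr ent c a w s' * (ν t' * gValK A pr ent c a w t')
        = (ν s' * ν t') * (gValK A pr ent c a w s' * gValK A pr ent c a w t') := by ring
      _ ≤ (ν (s' ∩ t') * ν (s' ∪ t')) *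
            (rValK A pr ent c a (s' ∩ t') * gValK A pr ent c a w (s' ∪ t')) :=
          mul_le_mul (hν s' hs' t' ht')
            (gValK_mul_le_rValK_gValK_all A pr ent c a w hp0 hp1 hA0 hA hmono s' t')
            (mul_nonneg (hg0 _) (hg0 _)) (mul_nonneg (hν0 _) (hν0 _))
      _ = ν (s' ∩ t') * rValK A pr ent c a (s' ∩ t') *
            (ν (s' ∪ t') * gValK A pr ent c a w (s' ∪ t')) := by ring
  set L : Bool → Bool → R :=
    fun b₁ b₂ => ∑ W ∈ U.powerset, ν W * rValK A pr ent c a W * cellWt m₁ m₂ b₁ b₂ W with hLdef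
  set M : Bool → Bool → R :=
    fun b₁ b₂ => ∑ W ∈ U.powerset, ν W * gValK A pr ent c a w W * cellWt m₁ m₂ b₁ b₂ W
    with hMdef
  have hL0 : ∀ b₁ b₂, 0 ≤ L b₁ b₂ := fun b₁ b₂ =>
    Finset.sum_nonneg fun W _ => mul_nonneg (hνr0 W) (cellWt_nonneg _ _ _ _ _)
  have hM0 : ∀ b₁ b₂, 0 ≤ M b₁ b₂ := fun b₁ b₂ =>
    Finset.sum_nonneg fun W _ => mul_nonneg (hνg0 W) (cellWt_nonneg _ _ _ _ _)
  have hML : ∀ b₁ b₂, M b₁ b₂ ≤ L b₁ b₂ := fun b₁ b₂ =>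
    Finset.sum_le_sum fun W _ =>
      mul_le_mul_of_nonneg_right
        (mul_le_mul_of_nonneg_left (gValK_le_rValK hp0 hp1 hmono ent c a w W) (hν0 W))
        (cellWt_nonneg _ _ _ _ _)
  have H1 : L true false * L false true ≤ L false false * L true true := by
    have := cellBlock_mul_le U (fun W => ν W * rValK A pr ent c a W)
      (fun W => ν W * rValK A pr ent c a W) (fun W => ν W * rValK A pr ent c a W)
      (fun W => ν W * rValK A pr ent c a W) m₁ m₂ true false false true hνr0 hνr0 hνr0 hνr0 hνr
    simpa only [Bool.true_and, Bool.and_true, Bool.false_or, Bool.or_false] using this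
  have H2 : M true false * M false true ≤ L false false * M true true := by
    have := cellBlock_mul_le U (fun W => ν W * gValK A pr ent c a w W)
      (fun W => ν W * gValK A pr ent c a w W) (fun W => ν W * rValK A pr ent c a W)
      (fun W => ν W * gValK A pr ent c a w W) m₁ m₂ true false false true hνg0 hνg0 hνr0 hνg0 hνg
    simpa only [Bool.true_and, Bool.and_true, Bool.false_or, Bool.or_false] using this
  have hzero : M false false = L false false := by
    simp only [hMdef, hLdef]
    refine Finset.sum_congr rfl fun W hW => ?_
    have hWU : W ⊆ U := Finset.mem_powerset.1 hW
    by_cases hc : cellWt (R := R) m₁ m₂ false false W = 0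
    · rw [hc, mul_zero, mul_zero]
    · obtain ⟨h1, h2⟩ := of_cellWt_ne_zero hc
      have hm1 : m₁ ∉ W := fun h => Bool.false_ne_true (h1.1 h)
      have hm2 : m₂ ∉ W := fun h => Bool.false_ne_true (h2.1 h)
      by_cases he : ∃ r ∈ ent, r ∈ W
      · rw [hcov W hWU hm1 hm2 he]
        simp only [zero_mul]
      · have he' : ∀ r ∈ ent, r ∉ W := fun r hr hrW => he ⟨r, hr, hrW⟩
        rw [gValK_eq_rValK_of_no_entry A pr c a w he']
  have eΛ := sum_split_four U (fun W => ν W * rValK A pr ent c a W) m₁ m₂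
  have eF1 := sum_split_fst U (fun W => ν W * rValK A pr ent c a W) m₁ m₂
  have eF2 := sum_split_snd U (fun W => ν W * rValK A pr ent c a W) m₁ m₂
  have eM := sum_split_four U (fun W => ν W * gValK A pr ent c a w W) m₁ m₂
  have eX := sum_split_fst U (fun W => ν W * gValK A pr ent c a w W) m₁ m₂
  have eY := sum_split_snd U (fun W => ν W * gValK A pr ent c a w W) m₁ m₂
  have eXY := sum_split_both U (fun W => ν W * gValK A pr ent c a w W) m₁ m₂
  rw [eΛ, eF1, eF2, eM, eX, eY, eXY]
  have key := orTailBlock_nonneg (L false false) (L false true) (L true false) (L true true)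
    (M false false) (M false true) (M true false) (M true true)
    (hL0 _ _) (hM0 _ _) (hM0 _ _) (hM0 _ _) (hML _ _) (hML _ _) (hML _ _) hzero H1 H2
  simp only [hLdef, hMdef] at key
  exact key

end KFunctional

section KMain

variable {V : Type*} {E : Type*} [Fintype V] [DecidableEq V] [Fintype E] [DecidableEq E]
  {R : Type*} [Field R] [LinearOrder R] [IsStrictOrderedRing R]
  {arcs : E → Finset (V × V)} {s : V} {U : Finset V} {ent : Finset V} {c : V → E} {a w : V}

/-- **THEOREM (row 2′DARC at a k-entry OR-tail for covering markers).**  `OrTailK arcs s U ent c a`,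
`SameEnds`, the cluster law of `U` log-supermodular (`hν`), markers `m₁, m₂ ∈ U` covering the
entries (`hcov`), `t, w ∉ U ∪ {a, s}` ⟹ `Φ_D({s ↛ t in D + (a → w)}) ≥ 0` for the markers
`m₁, m₂` at every head. -/
theorem darc_of_orTailLsmK (pr : E → R) (hp : IsProbVec pr) (hS : SameEnds arcs)
    (h : OrTailK arcs s U ent c a) {m₁ m₂ : V} (hm₁ : m₁ ∈ U) (hm₂ : m₂ ∈ U)
    (hcov : ∀ W ⊆ U, m₁ ∉ W → m₂ ∉ W → (∃ r ∈ ent, r ∈ W) →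
      prob pr (coreLevel arcs s U W) = 0)
    (hν : ∀ W W', W ⊆ U → W' ⊆ U →
      prob pr (coreLevel arcs s U W) * prob pr (coreLevel arcs s U W') ≤
        prob pr (coreLevel arcs s U (W ∩ W')) * prob pr (coreLevel arcs s U (W ∪ W')))
    {t : V} (htC : t ∉ insert a U) (hts : t ≠ s) (hws : w ≠ s) (hwC : w ∉ insert a U) :
    DARC pr arcs s {t} m₁ m₂ a w := by
  have hC := h.closedInCoreU
  have hm₁a : m₁ ≠ a := fun e => h.a_notin (e ▸ hm₁)
  have hm₂a : m₂ ≠ a := fun e => h.a_notin (e ▸ hm₂)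
  have hm₁C : m₁ ∈ insert a U := Finset.mem_insert_of_mem hm₁
  have hm₂C : m₂ ∈ insert a U := Finset.mem_insert_of_mem hm₂
  have haC : a ∈ insert a U := Finset.mem_insert_self _ _
  unfold DARC
  rw [hC.phiC_gate_eq pr hS htC hts hm₁C hm₂C haC hws hwC]
  have hm1 : ∀ W : Finset V, (fun _ : Finset V => (1 : R)) (insert a W) = (fun _ => (1 : R)) W :=
    fun _ => rfl
  have hmp : ∀ W : Finset V, (fun W : Finset V => if m₁ ∈ W then (1 : R) else 0) (insert a W) =
      (fun W : Finset V => if m₁ ∈ W then (1 : R) else 0) W := by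
    intro W; simp only [Finset.mem_insert, hm₁a, false_or]
  have hmq : ∀ W : Finset V, (fun W : Finset V => if m₂ ∈ W then (1 : R) else 0) (insert a W) =
      (fun W : Finset V => if m₂ ∈ W then (1 : R) else 0) W := by
    intro W; simp only [Finset.mem_insert, hm₂a, false_or]
  have hmpq : ∀ W : Finset V,
      (fun W : Finset V => (if m₁ ∈ W then (1 : R) else 0) * (if m₂ ∈ W then (1 : R) else 0))
        (insert a W) =
      (fun W : Finset V => (if m₁ ∈ W then (1 : R) else 0) * (if m₂ ∈ W then (1 : R) else 0)) W := by
    intro W; simp only [Finset.mem_insert, hm₁a, hm₂a, false_or]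
  have eΛ := h.sum_R_eq pr t (fun _ => (1 : R)) hm1
  have eFa := h.sum_R_eq pr t (fun W => if m₁ ∈ W then (1 : R) else 0) hmp
  have eFb := h.sum_R_eq pr t (fun W => if m₂ ∈ W then (1 : R) else 0) hmq
  have eM := h.sum_G_eq (w := w) pr t (fun _ => (1 : R)) hm1
  have eX := h.sum_G_eq (w := w) pr t (fun W => if m₁ ∈ W then (1 : R) else 0) hmp
  have eY := h.sum_G_eq (w := w) pr t (fun W => if m₂ ∈ W then (1 : R) else 0) hmq
  have eXY := h.sum_G_eq (w := w) pr t
    (fun W => (if m₁ ∈ W then (1 : R) else 0) * (if m₂ ∈ W then (1 : R) else 0)) hmpq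
  simp only [mul_one] at eΛ eM
  rw [eΛ, eFa, eFb, eM, eX, eY, eXY]
  obtain ⟨hA0, hAmono, hAlsm⟩ := OrTailU.head_props (U := U) (a := a) pr hp hS t
  exact orTailK_functional_nonneg U (fun W => prob pr (coreLevel arcs s U W))
    (fun X => prob pr (coreAvoidEvent arcs s t (insert a U) X)) pr ent c m₁ m₂ a w
    hp.nonneg hp.le_one (fun W => prob_nonneg hp _) (fun s' hs' t' ht' => hν s' t' hs' ht')
    hcov hA0 hAlsm hAmono

/-- **COROLLARY (each entry dominated by one of the markers).** -/
theorem darc_of_orTailLsmKDom (pr : E → R) (hp : IsProbVec pr) (hS : SameEnds arcs)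
    (h : OrTailK arcs s U ent c a) {m₁ m₂ : V} (hm₁ : m₁ ∈ U) (hm₂ : m₂ ∈ U)
    (hdom : ∀ r ∈ ent,
      (∀ W ⊆ U, r ∈ W → m₁ ∉ W → prob pr (coreLevel arcs s U W) = 0) ∨
      (∀ W ⊆ U, r ∈ W → m₂ ∉ W → prob pr (coreLevel arcs s U W) = 0))
    (hν : ∀ W W', W ⊆ U → W' ⊆ U →
      prob pr (coreLevel arcs s U W) * prob pr (coreLevel arcs s U W') ≤
        prob pr (coreLevel arcs s U (W ∩ W')) * prob pr (coreLevel arcs s U (W ∪ W')))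
    {t : V} (htC : t ∉ insert a U) (hts : t ≠ s) (hws : w ≠ s) (hwC : w ∉ insert a U) :
    DARC pr arcs s {t} m₁ m₂ a w := by
  refine darc_of_orTailLsmK pr hp hS h hm₁ hm₂ ?_ hν htC hts hws hwC
  intro W hW hm₁W hm₂W ⟨r, hr, hrW⟩
  rcases hdom r hr with hd | hd
  · exact hd W hW hrW hm₁W
  · exact hd W hW hrW hm₂W

/-- **COROLLARY (an out-tree, every entry below one of the markers).**  `U` an out-tree core,
the tail entered from the entries `ent`, each entry having `m₁` or `m₂` among its ancestors (or
being one of them): row 2′DARC at `a → w` for the markers `m₁, m₂` at every head — any number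
of branches into the tail. -/
theorem darc_of_orTailTreeK (pr : E → R) (hp : IsProbVec pr) (hS : SameEnds arcs)
    (h : OrTailK arcs s U ent c a) {c' : V → E} {par : V → V} {rk : V → ℕ}
    (hT : TreeCore arcs s U c' par rk) {m₁ m₂ : V} (hm₁ : m₁ ∈ U) (hm₂ : m₂ ∈ U)
    (hanc : ∀ r ∈ ent, IsAncestorIn U par r m₁ ∨ IsAncestorIn U par r m₂)
    {t : V} (htC : t ∉ insert a U) (hts : t ≠ s) (hws : w ≠ s) (hwC : w ∉ insert a U) :
    DARC pr arcs s {t} m₁ m₂ a w := by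
  refine darc_of_orTailLsmKDom pr hp hS h hm₁ hm₂ ?_ (hT.coreLevel_lsm pr hp) htC hts hws hwC
  intro r hr
  rcases hanc r hr with ha | ha
  · left
    intro W _ hrW hmW
    rw [hT.coreLevel_eq_empty_of_ancestor (h.ent_sub hr) hm₁ ha hrW hmW, prob_empty]
  · right
    intro W _ hrW hmW
    rw [hT.coreLevel_eq_empty_of_ancestor (h.ent_sub hr) hm₂ ha hrW hmW, prob_empty]

end KMain

end Summit.Ventures.PercRepro2.Coin
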